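import Mathlib
import Summits.ResolutionOfSingularities.ResolutionOfSingularities.Theorems.FrobeniusClosingSteerHironakaLUBranchOfCPPrelims
import Summits.ResolutionOfSingularities.ResolutionOfSingularities.Theorems.FrobeniusClosingSteerRadicandChainAdjoin
import Literature.AlgebraicGeometry.Resolution.LipmanValuativeQuadraticSequence
import Literature.AlgebraicGeometry.Resolution.QuadraticTransforms
import Literature.AlgebraicGeometry.Resolution.InseparableLocalUniformizationStepThree
import HarnessLib

/-!
# Crux `Steer` (stmt-ResolutionOfSingularities-16345), chain W4.1, σ-residual p = 2 LOW: `TamedMixedBranchReduction` —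
# a tamed mixed branch has a regular member, from Lipman's valuative quadratic sequence (currency (B))

OURS (campaign `res-hironaka`, rung L ★L-G4, slot W4.1, seat `res-type-026`; res-L0-w41-plan-1 RULING 18 (18b currency
(B), 18d hand) 2026-08-27T08:28:59Z + NOTE 08:34:22Z; res-L0-w41-idea-3 card 3 v3 / Sketch §5.5–5.6; NOT a statement of the
manuscript under review; AI review is weaker than expert review).

`tamedMixedBranchReduction (hLV : Lipman1978ValuativeQuadraticSequence)`: for a ground field `k`, a field `K` with
`trdeg_k K = 2` and a sequence `Y : ℕ → Subalgebra k K` of LOCAL `k`-subalgebras essentially of finite type with fraction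
field `K` forming a TAMED MIXED BRANCH (idea-3 §5.5 `IsTamedMixedBranch`, UNFOLDED verbatim with `IsPartialNormalisation`,
`IsIntegralOver`, `IsNormalIn` unfolded: every step is a quadratic transform («point step») or a proper partial
normalisation («curve step»: `Y n < Y (n+1)`, local, integral over `Y n`); infinitely many point steps; from some stage
on every point step is taken at a member integrally closed in `K`), SOME member is a regular local ring.

Proof (idea-3 §5.6 / plan-1 NOTE 18b (1)–(4)).  Chevalley: a valuation ring `O′ ⊇ k` of `K` dominates every member
(point steps dominate; a curve step `S ≤ S′` with `S′` integral over `S` dominates: `s ∈ S`, `s⁻¹ ∈ S′` integral over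
`S` ⇒ `s⁻¹ ∈ S`; `HironakaLUBranchOfCP.exists_valuationSubring_dominates`).  Let `ι` enumerate the point stages after the
taming index and put `R j := Y (ι j)`, `x j :=` the chart parameter of the quadratic transform `Y (ι j) → Y (ι j + 1)`,
of MAXIMAL valuation because the transform is dominated by `O′` (`IsQuadraticTransform.along`,
`IsQuadraticTransformAlong.exists_eq_locAtCentre`).  Then `(R, x)` is Lipman's normal sequence along `O′`
(`Lipman1978ValuativeQuadraticSequence`'s recursion, at EVERY index): `R 0` is normal and its own localisation at the
centre; and «next point stage = localisation at the centre of the INTEGRAL CLOSURE of `R j [𝔪/x j]`» — `⊇` since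
`Y (ι (j+1))` is integrally closed in `K` (tamed), contains the chart ring and has its units decided by `O′`; `⊆` since every
member between two point stages is integral over the quadratic transform `Q = (R j [𝔪/x j])_{centre}` (transitivity along the
curve steps) and integrality over a localisation clears to integrality over `R j [𝔪/x j]` with a denominator of value `1`
(Mathlib `IsIntegral.exists_multiple_integral_of_isLocalization`).  The fact's `∃ i, IsRegularLocalRing (R i)` is a
regular point stage.  [cite: Lipman1978, Thm. p. 151, (1.32)–(1.33) p. 174] [cite: Cutkosky2014, §2.1–2.2] [folklore]
-/

noncomputable section

-- `Summit.<S>.<S>.…` duplicates the summit name by design (single-problem summit).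
set_option linter.dupNamespace false

open Polynomial IsLocalRing

namespace Summit.ResolutionOfSingularities.ResolutionOfSingularities.Theorems.SwitchingDichotomy

open Literature.AlgebraicGeometry.Resolution

namespace TamedMixedBranch

universe u

variable {K : Type u} [Field K]

/-! ## (1) Instance-free integrality (idea-3 §5.5 `IsIntegralOver`) vs Mathlib's `IsIntegral` -/

/-- `IsIntegral ↥S z` iff some monic `q ∈ K[X]` with coefficients in `S` kills `z` (idea-3's instance-free
`IsIntegralOver S z`). [folklore] -/
theorem isIntegral_iff_exists_monic (S : Subring K) (z : K) :
    IsIntegral S z ↔ ∃ q : K[X], q.Monic ∧ (∀ i, q.coeff i ∈ S) ∧ q.eval z = 0 := by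
  constructor
  · rintro ⟨p, hp, hpz⟩
    refine ⟨p.map S.subtype, hp.map _, fun i => ?_, ?_⟩
    · rw [coeff_map]; exact (p.coeff i).2
    · rw [eval_map]; exact hpz
  · rintro ⟨q, hq, hc, hz⟩
    classical
    have hsub : (↑q.coeffs : Set K) ⊆ S := by
      intro a ha
      obtain ⟨n, -, rfl⟩ := mem_coeffs_iff.mp ha
      exact hc n
    refine ⟨q.toSubring S hsub, (monic_toSubring q S hsub).mpr hq, ?_⟩
    have : (q.toSubring S hsub).map S.subtype = q := map_toSubring q S hsub
    rw [← eval_map, show algebraMap (↥S) K = S.subtype from rfl, this, hz]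

/-- An INTEGRAL extension `S ≤ S'` of subrings of a field is dominating: a unit of `S'` lying in `S` is a unit of `S`
(`s⁻¹` integral over `S ∋ s` forces `s⁻¹ ∈ S`). [folklore] -/
theorem subringDominates_of_forall_isIntegral {S S' : Subring K} (hle : S ≤ S')
    (hint : ∀ z ∈ S', IsIntegral S z) : SubringDominates S S' :=
  ⟨hle, fun _ hz hzinv => RadicandChainAdjoin.inv_mem_of_isIntegral S hz (hint _ hzinv)⟩

/-- Transitivity: `z` integral over `S'` and `S'` integral over `S ≤ S'` ⇒ `z` integral over `S`. [folklore] -/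
theorem isIntegral_trans_subring {S S' : Subring K} (hle : S ≤ S') (hS' : ∀ w ∈ S', IsIntegral S w)
    {z : K} (hz : IsIntegral S' z) : IsIntegral S z := by
  letI : Algebra S S' := (Subring.inclusion hle).toAlgebra
  haveI : IsScalarTower S S' K := IsScalarTower.of_algebraMap_eq (fun _ => rfl)
  haveI : Algebra.IsIntegral S S' := ⟨fun w => by
    have h := hS' w w.2
    exact (isIntegral_algHom_iff (IsScalarTower.toAlgHom S S' K) Subtype.val_injective).mp h⟩
  exact isIntegral_trans z hz

/-! ## (2) Integral closure of a localisation at the centre -/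

/-- **Integrality over `B_{𝔪_O ∩ B}` clears to integrality over `B`** with a denominator of value `1`: if `z` is
integral over `locAtCentre B O` then `z = a · t⁻¹` with `a` integral over `B`, `t ∈ B`, `O.valuation t = 1`.
(Mathlib `IsIntegral.exists_multiple_integral_of_isLocalization`.) [folklore] -/
theorem exists_integral_mul_inv_of_isIntegral_locAtCentre {B : Subring K} {O : ValuationSubring K}
    (h : B ≤ O.toSubring) {z : K} (hz : IsIntegral (locAtCentre B O) z) :
    ∃ a t : K, IsIntegral B a ∧ t ∈ B ∧ O.valuation t = 1 ∧ z = a * t⁻¹ := by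
  haveI := isLocalization_locAtCentre h
  letI : Algebra (locAtCentre B O) K := (locAtCentre B O).subtype.toAlgebra
  haveI : IsScalarTower B (locAtCentre B O) K := IsScalarTower.of_algebraMap_eq (fun _ => rfl)
  obtain ⟨m, hm⟩ := IsIntegral.exists_multiple_integral_of_isLocalization (subringCentre B O h).primeCompl z hz
  have hv : O.valuation ((m : B) : K) = 1 := valuation_eq_one_of_not_mem_subringCentre h m.2
  have h0 : ((m : B) : K) ≠ 0 := ne_zero_of_valuation_eq_one hv
  refine ⟨((m : B) : K) * z, (m : B), ?_, (m : B).2, hv, ?_⟩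
  · have : (m : B) • z = ((m : B) : K) * z := by rw [Algebra.smul_def]; rfl
    rw [← this]; exact hm
  · rw [mul_comm, ← mul_assoc, inv_mul_cancel₀ h0, one_mul]

/-! ## (3) The reduction -/

/-- **`TamedMixedBranchReduction`** (idea-3 §5.6, currency (B) of plan-1 RULING 18b): from
`Lipman1978ValuativeQuadraticSequence`, every TAMED MIXED BRANCH of local `k`-subalgebras essentially of finite type with
fraction field `K`, `trdeg_k K = 2`, has a regular member.  The branch hypothesis is idea-3's `IsTamedMixedBranch`
(Sketch §5.5) UNFOLDED: (1) every step `Y n → Y (n+1)` is a quadratic transform or a proper partial normalisation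
(`Y n < Y (n+1)`, `Y (n+1)` local and integral over `Y n`, integrality in the instance-free form «some monic `q ∈ K[X]`
with coefficients in `Y n` kills `z`»); (2) infinitely many point steps; (3) from some stage on, point steps are taken
at members integrally closed in `K`.  See the module docstring for the proof.
[cite: Lipman1978, Thm. p. 151, (1.32)–(1.33) p. 174] [cite: Cutkosky2014, §2.1–2.2] [folklore] -/
theorem tamedMixedBranchReduction (hLV : Lipman1978ValuativeQuadraticSequence.{u})
    (k : Type u) [Field k] [Algebra k K] (Y : ℕ → Subalgebra k K) (htr : Algebra.trdeg k K = 2)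
    (hY : ∀ n, IsLocalRing (Y n) ∧ Algebra.EssFiniteType k (Y n) ∧ IsFractionRing (Y n) K)
    (hstep : ∀ n, IsQuadraticTransform (Y n).toSubring (Y (n + 1)).toSubring ∨
      ((Y n).toSubring ≤ (Y (n + 1)).toSubring ∧ (Y n).toSubring ≠ (Y (n + 1)).toSubring ∧
        IsLocalRing (Y (n + 1)).toSubring ∧
        ∀ z ∈ (Y (n + 1)).toSubring, ∃ q : K[X], q.Monic ∧ (∀ i, q.coeff i ∈ (Y n).toSubring) ∧ q.eval z = 0))
    (hinf : ∀ n₀, ∃ n, n₀ ≤ n ∧ IsQuadraticTransform (Y n).toSubring (Y (n + 1)).toSubring)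
    (htame : ∃ n₀, ∀ n, n₀ ≤ n → IsQuadraticTransform (Y n).toSubring (Y (n + 1)).toSubring →
      ∀ z : K, (∃ q : K[X], q.Monic ∧ (∀ i, q.coeff i ∈ (Y n).toSubring) ∧ q.eval z = 0) → z ∈ (Y n).toSubring) :
    ∃ n, IsRegularLocalRing (Y n) := by
  classical
  set T : ℕ → Subring K := fun n => (Y n).toSubring with hT
  haveI hTloc : ∀ n, IsLocalRing (T n) := fun n => (hY n).1
  haveI hTnoeth : ∀ n, IsNoetherianRing (T n) := fun n =>
    haveI := (hY n).2.1
    (Algebra.EssFiniteType.isNoetherianRing k (Y n) : IsNoetherianRing (Y n))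
  -- (a) every step is integral-or-quadratic, hence dominating; the branch is monotone
  have hle : ∀ n, T n ≤ T (n + 1) := fun n => by
    rcases hstep n with h | h
    · exact h.dominates.1
    · exact h.1
  have hdom : ∀ n, SubringDominates (T n) (T (n + 1)) := fun n => by
    rcases hstep n with h | ⟨h1, -, -, h4⟩
    · exact h.dominates
    · exact subringDominates_of_forall_isIntegral h1 fun z hz =>
        (isIntegral_iff_exists_monic (T n) z).mpr (h4 z hz)
  have hmono : Monotone T := monotone_nat_of_le_succ hle
  -- (b) Chevalley: a valuation ring dominating the branch; it contains `k`
  obtain ⟨O, hO⟩ := HironakaLUBranchOfCP.exists_valuationSubring_dominates T hdom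
  have hkO : ∀ c : k, algebraMap k K c ∈ O := fun c => (hO 0).1 ((Y 0).algebraMap_mem c)
  -- (c) the point stages after the taming index
  obtain ⟨n₀, hn₀⟩ := htame
  let P : ℕ → Prop := fun n => n₀ ≤ n ∧ IsQuadraticTransform (T n) (T (n + 1))
  have hPinf : (setOf P).Infinite := by
    refine Set.infinite_of_forall_exists_gt fun m => ?_
    obtain ⟨n, hn, hq⟩ := hinf (max n₀ m + 1)
    exact ⟨n, ⟨le_trans (le_max_left _ _) (Nat.le_of_succ_le hn), hq⟩,
      lt_of_lt_of_le (Nat.lt_succ_of_le (le_max_right _ _)) hn⟩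
  let ι : ℕ → ℕ := Nat.nth P
  have hιP : ∀ j, P (ι j) := fun j => Nat.nth_mem_of_infinite hPinf j
  have hιmono : StrictMono ι := Nat.nth_strictMono hPinf
  -- between two consecutive point stages every step is a partial normalisation
  have hbetween : ∀ j n, ι j < n → n < ι (j + 1) → ¬ IsQuadraticTransform (T n) (T (n + 1)) := by
    intro j n h1 h2 hq
    have hPn : P n := ⟨le_trans (hιP j).1 h1.le, hq⟩
    have := Nat.le_nth_of_lt_nth_succ h2 hPn
    exact absurd this (not_le.mpr h1)
  -- (d) along `O` the point steps are THE quadratic transforms along `O`: chart parameters of maximal value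
  have halong : ∀ j, IsQuadraticTransformAlong O (T (ι j)) (T (ι j + 1)) := fun j =>
    (hιP j).2.along ⟨inferInstance, IsNoetherian.noetherian _⟩ (hO (ι j + 1))
  have hchart : ∀ j, ∃ x : T (ι j), x ∈ maximalIdeal (T (ι j)) ∧ x ≠ 0 ∧
      (∀ y ∈ maximalIdeal (T (ι j)), O.valuation (y : K) ≤ O.valuation (x : K)) ∧
      T (ι j + 1) = locAtCentre (blowupRing (T (ι j)) (x : K)) O := fun j => by
    obtain ⟨_, x, hx, h0, hmax, heq⟩ := (halong j).exists_eq_locAtCentre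
    exact ⟨x, hx, h0, hmax, heq⟩
  choose x hx𝔪 hx0 hxmax hTsucc using hchart
  -- (e) integrality along the curve steps: every member up to the next point stage is integral over `T (ι j + 1)`
  have hint_chain : ∀ j n, ι j + 1 ≤ n → n ≤ ι (j + 1) → ∀ z ∈ T n, IsIntegral (T (ι j + 1)) z := by
    intro j n hn1 hn2
    induction n, hn1 using Nat.le_induction with
    | base => exact fun z hz => isIntegral_algebraMap (A := K) (x := (⟨z, hz⟩ : T (ι j + 1)))
    | succ n hn1 ih =>
      intro z hz
      have hnq : ¬ IsQuadraticTransform (T n) (T (n + 1)) :=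
        hbetween j n (Nat.lt_of_succ_le hn1) (Nat.lt_of_succ_le hn2)
      rcases hstep n with h | ⟨h1, -, -, h4⟩
      · exact absurd h hnq
      · have hz' : IsIntegral (T n) z := (isIntegral_iff_exists_monic (T n) z).mpr (h4 z hz)
        exact isIntegral_trans_subring (hmono hn1) (ih (Nat.le_of_succ_le hn2)) hz'
  -- (f) the data for Lipman's valuative sequence
  let R : ℕ → Subalgebra k K := fun j => Y (ι j)
  let xs : ℕ → K := fun j => (x j : K)
  have hR0O : (R 0).toSubring ≤ O.toSubring := (hO (ι 0)).1
  -- normality of the point stages ≥ n₀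
  have hnormal : ∀ j, ∀ z : K, IsIntegral (T (ι j)) z → z ∈ T (ι j) := fun j z hz =>
    hn₀ (ι j) (hιP j).1 (hιP j).2 z ((isIntegral_iff_exists_monic _ z).mp hz)
  -- adjoin-shape: a local subalgebra dominated by `O` is its own localisation at the centre
  have hadj : Algebra.adjoin k {y : K | ∃ a ∈ R 0, ∃ s ∈ R 0, s⁻¹ ∈ O ∧ y = a * s⁻¹} = R 0 := by
    apply le_antisymm
    · refine Algebra.adjoin_le ?_
      rintro _ ⟨a, ha, s, hs, hsO, rfl⟩
      exact (Y (ι 0)).mul_mem ha ((hO (ι 0)).2 s hs hsO)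
    · intro a ha
      exact Algebra.subset_adjoin ⟨a, ha, 1, (R 0).one_mem, by simp, by simp⟩
  have hic : IsIntegrallyClosed (R 0) := by
    haveI := (hY (ι 0)).2.2
    refine (isIntegrallyClosed_iff K).mpr fun {z} hz => ?_
    exact ⟨⟨z, hnormal 0 z hz⟩, rfl⟩
  -- (g) the recursion: next point stage = localisation at the centre of the integral closure of the chart ring
  have hrec : ∀ j : ℕ,
      xs j ∈ R j ∧ O.valuation (xs j) < 1 ∧
        (∀ y ∈ R j, O.valuation y < 1 → O.valuation y ≤ O.valuation (xs j)) ∧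
        R (j + 1) =
          Algebra.adjoin k {y : K | ∃ a ∈ Algebra.adjoin k {z : K | IsIntegral
              ↥(Algebra.adjoin k ((R j : Set K) ∪
                {w : K | ∃ a ∈ R j, O.valuation a < 1 ∧ w = a * (xs j)⁻¹})) z},
            ∃ s ∈ Algebra.adjoin k {z : K | IsIntegral
              ↥(Algebra.adjoin k ((R j : Set K) ∪
                {w : K | ∃ a ∈ R j, O.valuation a < 1 ∧ w = a * (xs j)⁻¹})) z},
            s⁻¹ ∈ O ∧ y = a * s⁻¹} := by
    intro j
    have hdomj : SubringDominates (T (ι j)) O.toSubring := hO (ι j)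
    have hmemO : ∀ y : T (ι j), y ∈ maximalIdeal (T (ι j)) ↔ O.valuation (y : K) < 1 :=
      (subringDominates_valuationSubring_iff hdomj.1).mp hdomj
    refine ⟨(x j).2, (hmemO (x j)).mp (hx𝔪 j), fun y hy hvy => hxmax j ⟨y, hy⟩ ((hmemO ⟨y, hy⟩).mpr hvy), ?_⟩
    -- the chart ring `C = R j [𝔪 / x j]` as a `k`-subalgebra IS the blow-up chart ring
    set C : Subalgebra k K := Algebra.adjoin k ((R j : Set K) ∪
      {w : K | ∃ a ∈ R j, O.valuation a < 1 ∧ w = a * (xs j)⁻¹}) with hC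
    have hkT : Set.range (algebraMap k K) ⊆ (T (ι j) : Set K) := by
      rintro _ ⟨c, rfl⟩; exact (Y (ι j)).algebraMap_mem c
    have hCeq : C.toSubring = blowupRing (T (ι j)) (xs j) := by
      apply le_antisymm
      · rw [hC, Algebra.adjoin_eq_ring_closure]
        refine Subring.closure_le.mpr (Set.union_subset ?_ (Set.union_subset ?_ ?_))
        · exact hkT.trans (le_blowupRing (T (ι j)) (xs j))
        · exact le_blowupRing (T (ι j)) (xs j)
        · rintro _ ⟨a, ha, hva, rfl⟩
          rw [← div_eq_mul_inv]
          exact div_mem_blowupRing (R := T (ι j)) (xs j) (y := ⟨a, ha⟩) ((hmemO ⟨a, ha⟩).mpr hva)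
      · unfold blowupRing
        refine Subring.closure_le.mpr (Set.union_subset ?_ ?_)
        · intro a ha
          exact Algebra.subset_adjoin (Or.inl ha)
        · rintro _ ⟨y, hy, rfl⟩
          change (y : K) / xs j ∈ C
          rw [div_eq_mul_inv]
          exact Algebra.subset_adjoin (Or.inr ⟨y, y.2, (hmemO y).mp hy, rfl⟩)
    have hCT : C.toSubring ≤ T (ι j + 1) := by
      rw [hCeq, hTsucc j]; exact le_locAtCentre _ O
    have hCO : C.toSubring ≤ O.toSubring := hCT.trans (hO (ι j + 1)).1
    -- `N = {z | z integral over C}` as a set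
    set N : Subalgebra k K := Algebra.adjoin k {z : K | IsIntegral C z} with hN
    have hNmem : ∀ z : K, z ∈ N ↔ IsIntegral C z := by
      intro z
      have hNeq : N = (integralClosure C K).restrictScalars k := by
        apply le_antisymm
        · exact Algebra.adjoin_le fun w hw => hw
        · intro w hw; exact Algebra.subset_adjoin hw
      rw [hNeq]; rfl
    -- integrality over the subalgebra `C` vs over the subring `C.toSubring`
    have hCint : ∀ z : K, IsIntegral C z ↔ IsIntegral C.toSubring z := fun z => Iff.rfl
    -- the next point stage
    have hnext : T (ι (j + 1)) = (Algebra.adjoin k {y : K | ∃ a ∈ N, ∃ s ∈ N, s⁻¹ ∈ O ∧ y = a * s⁻¹}).toSubring := by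
      apply le_antisymm
      · -- `⊆`: every element of the next point stage is integral over the quadratic transform `(C)_{centre}`
        intro z hz
        have hι : ι j + 1 ≤ ι (j + 1) := hιmono (Nat.lt_succ_self j)
        have hz1 : IsIntegral (T (ι j + 1)) z := hint_chain j (ι (j + 1)) hι le_rfl z hz
        have hz2 : IsIntegral (locAtCentre C.toSubring O) z := by
          refine isIntegral_of_subring_le (le_of_eq ?_) hz1
          rw [hTsucc j, hCeq]
        obtain ⟨a, t, ha, ht, hvt, rfl⟩ := exists_integral_mul_inv_of_isIntegral_locAtCentre hCO hz2
        refine Algebra.subset_adjoin ⟨a, (hNmem a).mpr ((hCint a).mpr ha), t,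
          (hNmem t).mpr ((hCint t).mpr (isIntegral_algebraMap (A := K) (x := (⟨t, ht⟩ : C.toSubring)))),
          ?_, rfl⟩
        rw [← O.valuation_le_one_iff, map_inv₀, hvt, inv_one]
      · -- `⊇`: the next point stage is integrally closed, contains the chart ring, and its units are decided by `O`
        change (Algebra.adjoin k _ : Subalgebra k K) ≤ R (j + 1)
        refine Algebra.adjoin_le ?_
        rintro _ ⟨a, ha, s, hs, hsO, rfl⟩
        have hCT' : C.toSubring ≤ T (ι (j + 1)) := hCT.trans (hmono (hιmono (Nat.lt_succ_self j)))
        have ha' : a ∈ T (ι (j + 1)) :=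
          hnormal (j + 1) a (isIntegral_of_subring_le hCT' ((hCint a).mp ((hNmem a).mp ha)))
        have hs' : s ∈ T (ι (j + 1)) :=
          hnormal (j + 1) s (isIntegral_of_subring_le hCT' ((hCint s).mp ((hNmem s).mp hs)))
        exact (T (ι (j + 1))).mul_mem ha' ((hO (ι (j + 1))).2 s hs' hsO)
    exact SetLike.ext' (congrArg (fun S : Subring K => (S : Set K)) hnext)
  obtain ⟨i, hi⟩ := hLV k K O R xs hkO htr (hY (ι 0)).2.1 (hY (ι 0)).2.2 hR0O hadj hic (fun i _ => hrec i)
  exact ⟨ι i, hi⟩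

end TamedMixedBranch

end Summit.ResolutionOfSingularities.ResolutionOfSingularities.Theorems.SwitchingDichotomy

end
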